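import Summits.ResolutionOfSingularities.ResolutionOfSingularities.Theorems.DescentDescentPerfectToAllLevelResolution
import Summits.ResolutionOfSingularities.ResolutionOfSingularities.Theorems.DescentDescentPerfectToAllFgModel
import Summits.ResolutionOfSingularities.ResolutionOfSingularities.Theorems.DescentDescentPerfectToAllRobustModel
import Summits.ResolutionOfSingularities.ResolutionOfSingularities.Theorems.WeightedInvariantDescentReducedToIntegral
import Literature.AlgebraicGeometry.Resolution.SmoothOfRegularPerfectField
import Literature.AlgebraicGeometry.Resolution.SmoothStalksRegular
import Literature.AlgebraicGeometry.Resolution.AlterationsDescentStage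
import Literature.AlgebraicGeometry.Resolution.ResolutionGlue
import Mathlib.FieldTheory.PurelyInseparable.PerfectClosure
import Mathlib.FieldTheory.IsPerfectClosure
import HarnessLib

/-!
# Crux `PrimeFieldToPerfect` (stmt-ResolutionOfSingularities-15233), line `birth`: sub-goal `smoothTwist_of_finite`

The finite-ground-field case of the open kernel `SmoothTwist p` of the crux.

**Statement.** Let `p` be a prime and assume resolution of singularities (`h`) for integral
separated schemes of finite type over every finitely generated field of characteristic `p`.
Let `K` be a *finite* field of characteristic `p` and `X₀ → Spec K` separated of finite type,
such that the base change `X₀ ×_K L` to some perfect purely inseparable extension `L ⊇ K` is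
integral. Then some finite purely inseparable `K'/K` carries a proper birational
`π : Y → X₀ ×_K K'` with `Y → Spec K'` smooth.

**Proof sketch.** Take `K' := K`.
* `X₀` is integral: `X₀ ×_K L → X₀` is the base change of the fpqc cover `Spec L → Spec K`,
  hence flat and surjective, and integrality descends along flat surjective morphisms
  (`DeJong1996.Stage.isIntegral_of_flat_surjective`).
* A finite field is finitely generated as a field (closure of all its elements), so `h` gives a
  resolution `π₀ : Y → X₀`: proper, birational, `Y` regular.
* A finite field is perfect, and a regular scheme locally of finite type over a perfect field is
  smooth (`smooth_of_isRegular_of_perfectField`), so `Y → Spec K` is smooth.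
* Finally `Spec.map (algebraMap K K) = 𝟙`, so `pullback.fst : X₀ ×_K K → X₀` is an
  isomorphism; put `π := π₀ ≫ (pullback.fst)⁻¹`. Properness and birationality are preserved by
  post-composition with an isomorphism, and `π ≫ pullback.snd = π₀ ≫ f₀ ≫ s⁻¹` is smooth.

[folklore]
-/

noncomputable section

set_option linter.dupNamespace false -- mandated namespace of this single-conjunct summit

open CategoryTheory CategoryTheory.Limits AlgebraicGeometry TopologicalSpace
open Literature.AlgebraicGeometry.Resolution

namespace Summit.ResolutionOfSingularities.ResolutionOfSingularities.Theorems.PrimeFieldToPerfect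

universe u

/-- Assembly step: if `π₀ : Y → X₀` is proper and birational with `π₀ ≫ f₀` smooth, and
`s : S' → S` is an isomorphism, then `π := π₀ ≫ (pullback.fst f₀ s)⁻¹ : Y → X₀ ×_S S'` is proper
and birational and `π ≫ pullback.snd f₀ s = π₀ ≫ f₀ ≫ s⁻¹` is smooth. [folklore] -/
private theorem assemble {X₀ Y S S' : Scheme.{u}} (f₀ : X₀ ⟶ S) (s : S' ⟶ S) [IsIso s]
    (π₀ : Y ⟶ X₀) (hpr : IsProper π₀) (hb : IsBirational π₀) (hsm : Smooth (π₀ ≫ f₀)) :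
    ∃ π : Y ⟶ pullback f₀ s, IsProper π ∧ IsBirational π ∧ Smooth (π ≫ pullback.snd f₀ s) := by
  haveI := hpr
  haveI := hsm
  refine ⟨π₀ ≫ inv (pullback.fst f₀ s), inferInstance, hb.comp_iso _, ?_⟩
  have e : (π₀ ≫ inv (pullback.fst f₀ s)) ≫ pullback.snd f₀ s = (π₀ ≫ f₀) ≫ inv s := by
    simp only [Category.assoc]
    congr 1
    rw [IsIso.inv_comp_eq, ← cancel_mono s, Category.assoc, Category.assoc, IsIso.inv_hom_id,
      Category.comp_id, pullback.condition]
  rw [e]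
  infer_instance

/-- **Finite-field case of the kernel `SmoothTwist`.** Granted resolution of singularities `h`
for integral separated finite-type schemes over finitely generated fields of characteristic `p`:
for a finite field `K` of characteristic `p` and a separated finite-type `X₀ → Spec K` whose base
change to some perfect purely inseparable `L ⊇ K` is integral, there is a finite purely
inseparable `K'/K` (namely `K' = K`) and a proper birational `π : Y → X₀ ×_K K'` with
`Y → Spec K'` smooth. Proof: `X₀` is integral (integrality descends along the flat surjective
`X₀ ×_K L → X₀`); `K` is finitely generated, so `h` gives a resolution `Y → X₀` with `Y` regular;
`K` is perfect, so the regular finite-type `K`-scheme `Y` is smooth over `K`; transport along the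
isomorphism `X₀ ×_K K ≅ X₀`. [folklore] -/
theorem smoothTwist_of_finite (p : ℕ) (hp : p.Prime) (h : ∀ (K : Type) [Field K] [CharP K p], (∃ s : Finset K, Subfield.closure (s : Set K) = ⊤) → ∀ (X : Scheme.{0}) (f : X ⟶ Spec (.of K)), IsSeparated f → LocallyOfFiniteType f → QuasiCompact f → IsIntegral X → Scheme.HasResolution X) (K : Type) [Field K] [CharP K p] [Finite K] (X₀ : Scheme.{0}) (f₀ : X₀ ⟶ Spec (.of K)) (hs : IsSeparated f₀) (hl : LocallyOfFiniteType f₀) (hq : QuasiCompact f₀) (hgeom : ∃ (L : Type) (_ : Field L) (_ : PerfectField L) (_ : Algebra K L) (_ : IsPurelyInseparable K L), IsIntegral (pullback f₀ (Spec.map (CommRingCat.ofHom (algebraMap K L))))) : ∃ (K' : Type) (_ : Field K') (_ : Algebra K K') (_ : IsPurelyInseparable K K') (_ : Module.Finite K K') (Y : Scheme.{0}) (π : Y ⟶ pullback f₀ (Spec.map (CommRingCat.ofHom (algebraMap K K')))), IsProper π ∧ IsBirational π ∧ Smooth (π ≫ pullback.snd f₀ (Spec.map (CommRingCat.ofHom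 (algebraMap K K')))) := by
  have _hp : Fact p.Prime := ⟨hp⟩
  -- (a) `X₀` is integral: integrality descends along the flat surjective `X₀ ×_K L → X₀`.
  obtain ⟨L, _, _, _, _, hint⟩ := hgeom
  haveI := hint
  haveI : Flat (Spec.map (CommRingCat.ofHom (algebraMap K L))) :=
    DeJong1996.Stage.flat_specMap _
  haveI : Surjective (Spec.map (CommRingCat.ofHom (algebraMap K L))) :=
    DeJong1996.Stage.surjective_specMap _
  haveI : IsIntegral X₀ :=
    DeJong1996.Stage.isIntegral_of_flat_surjective
      (pullback.fst f₀ (Spec.map (CommRingCat.ofHom (algebraMap K L))))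
  -- (b) `K` is finitely generated as a field, so `h` resolves `X₀`.
  have hFG : ∃ s : Finset K, Subfield.closure (s : Set K) = ⊤ := by
    haveI := Fintype.ofFinite K
    exact ⟨Finset.univ, by rw [Finset.coe_univ, Subfield.closure_univ]⟩
  obtain ⟨Y, π₀, hres⟩ := h K hFG X₀ f₀ hs hl hq inferInstance
  -- (c) `Y` is regular of finite type over the perfect field `K`, hence smooth over `K`.
  haveI := hres.isProper
  haveI := hl
  have hsm : Smooth (π₀ ≫ f₀) := smooth_of_isRegular_of_perfectField (π₀ ≫ f₀) hres.isRegular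
  -- (d) `K' := K`: `Spec.map (algebraMap K K) = 𝟙` is an isomorphism; assemble.
  haveI : IsIso (Spec.map (CommRingCat.ofHom (algebraMap K K))) := by
    rw [Algebra.algebraMap_self, CommRingCat.ofHom_id, Spec.map_id]
    infer_instance
  obtain ⟨π, hπ⟩ := assemble f₀ (Spec.map (CommRingCat.ofHom (algebraMap K K))) π₀
    hres.isProper hres.isBirational hsm
  exact ⟨K, inferInstance, inferInstance, inferInstance, inferInstance, Y, π, hπ⟩

end Summit.ResolutionOfSingularities.ResolutionOfSingularities.Theorems.PrimeFieldToPerfect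

end
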